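import Summits.CriticalPhenomena.PercolationContinuityZ3.Theorems.PercNearOneGluingNoHeavyLowerTailSmallBlockTransfer
import HarnessLib

/-!
# `NoHeavyLowerTail` (stmt-CriticalPhenomena-4575) — small-block transfer for the PRINCIPAL up-sets `{o ↔ every b ∈ W}`

Support file (coupling seat `prim-cplus-coupling`, gen 2; `--supports stmt-CriticalPhenomena-4575`).  No definitions, no
named facts, no sorries.  Bond percolation `μ = prodBernoulli w` on `Fin n`, relays `A`, level `j`,
`π(v) = A.filter (fun z => ω ∈ openConn v z)`, `R_v = {|π(v)| ≤ j}`.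

`smallBlockTransfer_allOf` — the principal-up-set case of the small-block transfer / trace domination (report
MAX-TRANSFER.md §"Finer structure 1. DOM" on the item: "principal up-sets `{⊇ T}` are single exchanges"): for a finite
set `W` containing SOME `t ≠ a` with `μ(R_t) ≤ μ(R_a)`,

  `μ(o ↔ b for every b ∈ W, |π(o)| ≤ j) ≤ μ(o ↔ b for every b ∈ W, |π(a)| ≤ j)`.

On `{o ↔ a}` the two lightness events agree; off it, on the event `o ↔ t` one has `π(o) = π(t)`, `a ↮ t`, and
`B = {t ↔ o} ∩ ⋂_{b ∈ W} {t ↔ b}` is closed under (shrinking `C_a`, enlarging `C_t`), so the landed loss-free transfer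
`SmallBlockTransfer.transfer_le` (van den Berg–Häggström–Kahn 2006 Thm. 1.5) applies with `s = a`.  Only ONE member of `W`
needs to be no lonelier than `a` (contrast `smallBlockTransfer_singleton/_pair`, and the open general small-block transfer,
which is about `o ↔ SOME b ∈ W` and needs every `b ∈ W` no lonelier than `a`).
[cite: VandenbergHaggstromKahn2005, Thm. 1.5 (p. 7)]
-/

noncomputable section

namespace Summit.CriticalPhenomena.PercolationContinuityZ3.Theorems

open MeasureTheory Set Literature.Probability.LatticeModels Literature.Probability.Percolation
open scoped Classical BigOperators

variable {n : ℕ}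

open SmallBlockTransfer in
/-- **Small-block transfer for a principal up-set.**  If `t ∈ W`, `t ≠ a` and `μ(R_t) ≤ μ(R_a)`, then
`μ(∀ b ∈ W, o ↔ b; |π(o)| ≤ j) ≤ μ(∀ b ∈ W, o ↔ b; |π(a)| ≤ j)`. [cite: VandenbergHaggstromKahn2005, Thm. 1.5 (p. 7) — corollary] -/
theorem smallBlockTransfer_allOf (w : Sym2 (Fin n) → unitInterval) (A W : Finset (Fin n)) (o a : Fin n)
    {t : Fin n} (htW : t ∈ W) (hat : a ≠ t) (j : ℕ)
    (hle : (prodBernoulli w).real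
        {ω : BondConfig (Fin n) | (A.filter fun z => ω ∈ openConn t z).card ≤ j} ≤
      (prodBernoulli w).real
        {ω : BondConfig (Fin n) | (A.filter fun z => ω ∈ openConn a z).card ≤ j}) :
    (prodBernoulli w).real {ω : BondConfig (Fin n) | (∀ b ∈ W, ω ∈ openConn o b) ∧
        (A.filter fun z => ω ∈ openConn o z).card ≤ j} ≤
      (prodBernoulli w).real {ω : BondConfig (Fin n) | (∀ b ∈ W, ω ∈ openConn o b) ∧
        (A.filter fun z => ω ∈ openConn a z).card ≤ j} := by
  set μ := prodBernoulli w with hμ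
  have hmeas : ∀ S : Set (BondConfig (Fin n)), MeasurableSet S :=
    fun S => (Set.toFinite S).measurableSet
  -- the type-(−) event `B = {t ↔ o} ∩ ⋂_{b ∈ W} {t ↔ b}`
  set B : Set (BondConfig (Fin n)) := (openConn t o : Set (BondConfig (Fin n))) ∩
    {ω | ∀ b ∈ W, ω ∈ openConn t b} with hB
  have hBtype : ∀ ⦃ω ω' : BondConfig (Fin n)⦄, openEdgeCluster ω' a ⊆ openEdgeCluster ω a →
      openEdgeCluster ω t ⊆ openEdgeCluster ω' t → ω ∈ B → ω' ∈ B := by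
    intro ω ω' ha ht' hω
    refine ⟨typeMinus_openConn a t o ha ht' hω.1, fun b hb => typeMinus_openConn a t b ha ht' (hω.2 b hb)⟩
  have key := transfer_le w hat A j (B := B) hBtype hle
  -- split both sides along `C = {o ↔ a}`
  set C : Set (BondConfig (Fin n)) := openConn o a with hC
  set L : Set (BondConfig (Fin n)) := {ω | (∀ b ∈ W, ω ∈ openConn o b) ∧
      (A.filter fun z => ω ∈ openConn o z).card ≤ j} with hL
  set R : Set (BondConfig (Fin n)) := {ω | (∀ b ∈ W, ω ∈ openConn o b) ∧
      (A.filter fun z => ω ∈ openConn a z).card ≤ j} with hR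
  have hsplit : ∀ S : Set (BondConfig (Fin n)), μ.real S = μ.real (S ∩ C) + μ.real (S \ C) :=
    fun S => (measureReal_inter_add_sdiff (μ := μ) (s := S) (hmeas C)).symm
  have hLC : L ∩ C = R ∩ C := by
    ext ω
    simp only [hL, hR, hC, mem_inter_iff, mem_setOf_eq]
    constructor
    · rintro ⟨⟨hW, hcard⟩, hoa⟩
      exact ⟨⟨hW, by rwa [← filter_eq_of_reachable A (hoa : (openGraph ω).Reachable o a)]⟩, hoa⟩
    · rintro ⟨⟨hW, hcard⟩, hoa⟩
      exact ⟨⟨hW, by rwa [filter_eq_of_reachable A (hoa : (openGraph ω).Reachable o a)]⟩, hoa⟩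
  -- off `C`: the events are the two sides of the transfer
  have hLoff : L \ C = (openConn a t)ᶜ ∩
      ({ω : BondConfig (Fin n) | (A.filter fun z => ω ∈ openConn t z).card ≤ j} ∩ B) := by
    ext ω
    simp only [hL, hC, hB, mem_sdiff, mem_setOf_eq, mem_inter_iff, mem_compl_iff]
    constructor
    · rintro ⟨⟨hW, hcard⟩, hoa⟩
      have hot : (openGraph ω).Reachable o t := hW t htW
      refine ⟨fun hat' => hoa ?_, ?_, (hot.symm : (openGraph ω).Reachable t o), fun b hb => ?_⟩
      · exact (hot.trans (hat' : (openGraph ω).Reachable a t).symm : (openGraph ω).Reachable o a)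
      · rwa [← filter_eq_of_reachable A hot]
      · exact (hot.symm.trans (hW b hb : (openGraph ω).Reachable o b) : (openGraph ω).Reachable t b)
    · rintro ⟨hat', hcard, hto, hW⟩
      have hto' : (openGraph ω).Reachable t o := hto
      refine ⟨⟨fun b hb => (hto'.symm.trans (hW b hb : (openGraph ω).Reachable t b) :
        (openGraph ω).Reachable o b), by rwa [filter_eq_of_reachable A hto'.symm]⟩, fun hoa => hat' ?_⟩
      exact ((hto'.trans (hoa : (openGraph ω).Reachable o a)).symm : (openGraph ω).Reachable a t)
  have hRoff : R \ C = (openConn a t)ᶜ ∩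
      (B ∩ {ω : BondConfig (Fin n) | (A.filter fun z => ω ∈ openConn a z).card ≤ j}) := by
    ext ω
    simp only [hR, hC, hB, mem_sdiff, mem_setOf_eq, mem_inter_iff, mem_compl_iff]
    constructor
    · rintro ⟨⟨hW, hcard⟩, hoa⟩
      have hot : (openGraph ω).Reachable o t := hW t htW
      refine ⟨fun hat' => hoa ?_, ⟨(hot.symm : (openGraph ω).Reachable t o), fun b hb => ?_⟩, hcard⟩
      · exact (hot.trans (hat' : (openGraph ω).Reachable a t).symm : (openGraph ω).Reachable o a)
      · exact (hot.symm.trans (hW b hb : (openGraph ω).Reachable o b) : (openGraph ω).Reachable t b)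
    · rintro ⟨hat', ⟨hto, hW⟩, hcard⟩
      have hto' : (openGraph ω).Reachable t o := hto
      refine ⟨⟨fun b hb => (hto'.symm.trans (hW b hb : (openGraph ω).Reachable t b) :
        (openGraph ω).Reachable o b), hcard⟩, fun hoa => hat' ?_⟩
      exact ((hto'.trans (hoa : (openGraph ω).Reachable o a)).symm : (openGraph ω).Reachable a t)
  rw [hsplit L, hsplit R, hLC, hLoff, hRoff]
  linarith
end Summit.CriticalPhenomena.PercolationContinuityZ3.Theorems
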